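import Summits.CriticalPhenomena.PercolationContinuityZ3.Theorems.PercNearOneGluingNoHeavyLowerTailCubicThreePointTerminalClosure
import Mathlib.Tactic.Ring
import Mathlib.Tactic.Linarith
import Mathlib.Tactic.Positivity
import Mathlib.Tactic.FieldSimp
import Mathlib.Tactic.LinearCombination
import HarnessLib

/-!
# `NoHeavyLowerTail` (stmt-CriticalPhenomena-4575) — the SHARP cubic three-point form `Hmax3`: dichotomy, canonical models
# (diluted star / clamped triangle), star–triangle duality, and closure under clamp / dilution

Support file (prover prim-gen-kcluster gen 9, k-cluster line; `--supports stmt-CriticalPhenomena-4575`).  Pure algebra over a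
commutative ring / a field / `ℝ`: no measure theory, no named facts, no definitions, no sorries.  Cell convention and the forms
`AG`, `Hqt`, `Ha = t·AG − e₃`, `Hb = q·AG − e₃` of `…CubicThreePointTerminalClosure` (`CubicThreePointTerminal.*`):
`(q, u₁, u₂, u₃, t) = (P(a|b|c), P(ab|c), P(ac|b), P(bc|a), P(abc))` for three terminals `a, b, c` of a weighted graph (abstractly: the five
cell masses `(μB, μP₁, μP₂, μP₃, μT)` of a 3-sunflower of up-sets `Uᵢ = Pᵢ ⊔ T`, `Uᵢ ∩ Uⱼ = T`, under a product measure); `AG = q t − e₂(u)`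
is Gladkov's form, `≥ 0` on every realizable law (tree `prodBernoulli_threePoint_strongHarris`).

## The sharp form and its two faces

The censused sharp cubic row of the cell (ttrl `sahi` RESULT 4, row `SF3-Hmax`: 0 violations in ≈ 1.9·10⁸ exact evaluations, tight on
whole weight-independent families) is `Hmax3 := max(q,t)·AG − e₃(u) ≥ 0`.  For `AG ≥ 0`, `max(q,t)·AG − e₃ = max(Ha, Hb)` (`max_Ha_Hb`),
and on the simplex `σ = 1`
  `Ha = t² − (t+u₁)(t+u₂)(t+u₃) = P(abc)² − P(ab)P(ac)P(bc)`,   `Hb = q² − (q+u₁)(q+u₂)(q+u₃) = P(a|b|c)² − ∏ᵢ P(i ∤ rest)`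
(`Ha_eq_sq_sub_prod`, `Hb_eq_sq_sub_prod`).  So `Hmax3 ≥ 0` is the DICHOTOMY  `P(abc)² ≥ P(ab)P(ac)P(bc)  ∨  P(a|b|c)² ≥ ∏ᵢ P(i ∤ rest)`;
neither disjunct holds alone (the first fails on sparse triangles, the second on dense stars), the two are exchanged by the duality
`D : q ↔ t` (`Ha_dual`), and `Hmax3 ⇒ H_{q+t}` (`Hqt_ge_max`; `⇒ AG⁺ ⇒ SHK3⁺` by `…TerminalClosure`).  For `k = 2` petals both disjuncts
are Harris; `k = 3` is the first case where only the disjunction is (conjecturally) valid.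
* `Ha ≡ 0` on STAR laws (independent arms `α, β, γ` to a hub; `Ha_star`), `Hb ≡ 0` on TRIANGLE laws (independent edges; `Hb_triangle`);
  the triangle with edge probabilities `(1−α, 1−β, 1−γ)` (edge opposite a terminal ↔ one minus that terminal's arm) is EXACTLY the dual
  law of the star (`triangle_eq_dual_star_*`), so the two vanishing loci cross along the self-dual locus `t = q`, which on stars is the
  star–triangle condition `αβ + αγ + βγ − αβγ = 1` (`star_t_sub_q`; `κ_△(1−α,1−β,1−γ) = 0` of Grimmett–Manolescu): the ridge of
  `{Hmax3 ≥ 0}` is the percolation Y–Δ locus (symmetric star: `p = 2 sin(π/18)`).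
* CANONICAL MODELS (`dilutedStar_*`): on the simplex with `t ≠ 0`, EVERY cell vector equals the law of the "diluted star" with arms
  `α = t/(t+u₃), β = t/(t+u₂), γ = t/(t+u₁)` run with probability `s = (t+u₁)(t+u₂)(t+u₃)/t²` and replaced by `a|b|c` otherwise, and
  `1 − s = Ha/t²` (`dilutedStar_one_sub_survival`).  Hence `{u ≥ 0, Ha ≥ 0} =` laws of diluted stars and, dually (`clampedTriangle_*`),
  `{u ≥ 0, Hb ≥ 0} =` laws of clamped triangles (triangle `p_ab = u₁/(q+u₁), …` with probability `s' = ∏(q+uᵢ)/q²`, all glued otherwise).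
  Both families are realizable by monotone sunflower systems (one extra "switch" coordinate), so the conjecture `Hmax3 ≥ 0` is
  EQUIVALENT to the exact description  "closure of the realizable 3-sunflower laws = {diluted stars} ∪ {clamped triangles}",
  with both boundary patches attained; in particular every quadratic row (Harris, `AG ≥ 0`) is subsumed.
* CLOSURE under clamp and dilution (`maxH_clamp_nonneg`, `maxH_dilute_nonneg`): `{AG ≥ 0, max(Ha,Hb) ≥ 0}` is invariant under
  `K_ε x = (1−ε)x + ε·δ_T` (glue all three with probability `ε`) and `Δ_ε x = (1−ε)x + ε·δ_B`, each face separately staying nonnegative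
  (`Ha_clamp`, `Hb_clamp`, `Ha_dilute`, `Hb_dilute`, `AG_clamp`).  Together with THEOREM A (SF3-Hmax) of `…TerminalClosure`
  (closure under the terminal–terminal edge `E_ab^l` = parallel composition with a chord, and the pendant move) and the factorisation
  of every clamped-triangle law as chord ∘ chord ∘ chord ∘ clamp under parallel composition (bilinear in the two laws), this gives:
  `{AG ≥ 0, Hmax3 ≥ 0}` is closed under PARALLEL COMPOSITION with any clamped-triangle law and, dually, under the meet with any
  diluted-star law — the join with a diluted star (two stars in parallel, `K_{2,3}`) is the one open case of the K3-semigroup property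
  (memo run/shared/lean/prim/prim-gen-kcluster/KCLUSTER-gen9.md §5).
[cite: Gladkov2024StrongFKG, Cor. 4.2 (the quadratic form AG)]; [cite: GrimmettManolescuAOP2013, star–triangle transformation
κ_△(p) = p₁+p₂+p₃−p₁p₂p₃−1 = 0]; [cite: GladkovZimin2024HK, §4 (one-coordinate decomposition)]
-/

namespace Summit.CriticalPhenomena.PercolationContinuityZ3.Theorems

namespace CubicThreePointSharp

open CubicThreePointTerminal

variable {R : Type*} [CommRing R]

/-! ### Identities (any commutative ring) -/

/-- `AG` is self-dual under `q ↔ t`. [folklore] -/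
theorem AG_dual (q u₁ u₂ u₃ t : R) : AG t u₁ u₂ u₃ q = AG q u₁ u₂ u₃ t := by
  simp only [AG]; ring

/-- Duality `q ↔ t` exchanges the two faces: `Ha(D x) = Hb(x)`. [folklore] -/
theorem Ha_dual (q u₁ u₂ u₃ t : R) : Ha t u₁ u₂ u₃ q = Hb q u₁ u₂ u₃ t := by
  simp only [Ha, Hb]; ring

/-- Duality `q ↔ t` exchanges the two faces: `Hb(D x) = Ha(x)`. [folklore] -/
theorem Hb_dual (q u₁ u₂ u₃ t : R) : Hb t u₁ u₂ u₃ q = Ha q u₁ u₂ u₃ t := by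
  simp only [Ha, Hb]; ring

/-- On the simplex, `Ha = t² − (t+u₁)(t+u₂)(t+u₃)` (`= P(abc)² − P(ab)·P(ac)·P(bc)`). [folklore] -/
theorem Ha_eq_sq_sub_prod {q u₁ u₂ u₃ t : R} (hσ : q + u₁ + u₂ + u₃ + t = 1) :
    Ha q u₁ u₂ u₃ t = t ^ 2 - (t + u₁) * (t + u₂) * (t + u₃) := by
  simp only [Ha]; linear_combination (t ^ 2) * hσ

/-- On the simplex, `Hb = q² − (q+u₁)(q+u₂)(q+u₃)` (`= P(a|b|c)² − P(c ∤ ab)·P(b ∤ ac)·P(a ∤ bc)`). [folklore] -/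
theorem Hb_eq_sq_sub_prod {q u₁ u₂ u₃ t : R} (hσ : q + u₁ + u₂ + u₃ + t = 1) :
    Hb q u₁ u₂ u₃ t = q ^ 2 - (q + u₁) * (q + u₂) * (q + u₃) := by
  simp only [Hb]; linear_combination (q ^ 2) * hσ

/-! ### Star and triangle laws; star–triangle duality -/

/-- STAR law (hub with independent arms `α, β, γ` to `a, b, c`): `Ha ≡ 0` identically
(`P(abc)² = P(ab)P(ac)P(bc)` on every hub network). [folklore] -/
theorem Ha_star (α β γ : R) :
    Ha (1 - (α * β + α * γ + β * γ) + 2 * (α * β * γ)) (α * β * (1 - γ)) (α * γ * (1 - β)) (β * γ * (1 - α))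
      (α * β * γ) = 0 := by
  simp only [Ha]; ring

/-- The star law has total mass `1`. [folklore] -/
theorem star_total (α β γ : R) :
    (1 - (α * β + α * γ + β * γ) + 2 * (α * β * γ)) + α * β * (1 - γ) + α * γ * (1 - β) + β * γ * (1 - α)
      + α * β * γ = 1 := by
  ring

/-- TRIANGLE law (independent edges of probabilities `z = p_ab, y = p_ac, x = p_bc`):
`(q,u₁,u₂,u₃,t) = ((1−x)(1−y)(1−z), z(1−x)(1−y), y(1−x)(1−z), x(1−y)(1−z), xy+xz+yz−2xyz)`; `Hb ≡ 0` identically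
(`P(a|b|c)² = ∏ P(i ∤ rest)` on every network of two-terminal blobs). [folklore] -/
theorem Hb_triangle (x y z : R) :
    Hb ((1 - x) * (1 - y) * (1 - z)) (z * (1 - x) * (1 - y)) (y * (1 - x) * (1 - z)) (x * (1 - y) * (1 - z))
      (x * y + x * z + y * z - 2 * (x * y * z)) = 0 := by
  simp only [Hb]; ring

/-- STAR–TRIANGLE DUALITY, `q`-component: the triangle with edge probabilities `(p_bc, p_ac, p_ab) = (1−α, 1−β, 1−γ)` (edge opposite a
terminal ↔ one minus that terminal's arm) has `q_Δ = t_⋆`. [cite: GrimmettManolescuAOP2013, star–triangle transformation] -/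
theorem triangle_eq_dual_star_q (α β γ : R) :
    (1 - (1 - α)) * (1 - (1 - β)) * (1 - (1 - γ)) = α * β * γ := by ring

/-- Star–triangle duality, petals: the complementary triangle has the SAME three petals as the star. [cite: GrimmettManolescuAOP2013, star–triangle transformation] -/
theorem triangle_eq_dual_star_u (α β γ : R) :
    (1 - γ) * (1 - (1 - α)) * (1 - (1 - β)) = α * β * (1 - γ) ∧
      (1 - β) * (1 - (1 - α)) * (1 - (1 - γ)) = α * γ * (1 - β) ∧
        (1 - α) * (1 - (1 - β)) * (1 - (1 - γ)) = β * γ * (1 - α) := by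
  refine ⟨by ring, by ring, by ring⟩

/-- Star–triangle duality, `t`-component: `t_Δ = q_⋆`; so the complementary triangle is the dual (`q ↔ t`) of the star, and the two
laws COINCIDE iff the star is self-dual, `t_⋆ = q_⋆`. [cite: GrimmettManolescuAOP2013, star–triangle transformation] -/
theorem triangle_eq_dual_star_t (α β γ : R) :
    (1 - α) * (1 - β) + (1 - α) * (1 - γ) + (1 - β) * (1 - γ) - 2 * ((1 - α) * (1 - β) * (1 - γ)) =
      1 - (α * β + α * γ + β * γ) + 2 * (α * β * γ) := by
  ring

/-- The self-duality defect of the star: `t_⋆ − q_⋆ = (αβ + αγ + βγ − αβγ) − 1`; it vanishes exactly on the Sykes–Essam star–triangle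
locus, which is therefore the ridge `{Ha = Hb = 0, e₃ > 0}` of the region `{Hmax3 ≥ 0}`. [cite: GrimmettManolescuAOP2013, star–triangle transformation] -/
theorem star_t_sub_q (α β γ : R) :
    α * β * γ - (1 - (α * β + α * γ + β * γ) + 2 * (α * β * γ)) = (α * β + α * γ + β * γ - α * β * γ) - 1 := by
  ring

/-! ### Canonical models: `{Ha ≥ 0}` = diluted stars (and dually `{Hb ≥ 0}` = clamped triangles) -/

section Canonical

variable {K : Type*} [Field K]

/-- DILUTED STAR, petal `u₁`: with arms `α = t/(t+u₃), β = t/(t+u₂), γ = t/(t+u₁)` and survival `s = (t+u₁)(t+u₂)(t+u₃)/t²`,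
`s·αβ(1−γ) = u₁`. [folklore] -/
theorem dilutedStar_u₁ {u₁ u₂ u₃ t : K} (ht : t ≠ 0) (h₁ : t + u₁ ≠ 0) (h₂ : t + u₂ ≠ 0) (h₃ : t + u₃ ≠ 0) :
    (t + u₁) * (t + u₂) * (t + u₃) / t ^ 2 * ((t / (t + u₃)) * (t / (t + u₂)) * (1 - t / (t + u₁))) = u₁ := by
  field_simp; ring

/-- Diluted star, petal `u₂`: `s·αγ(1−β) = u₂`. [folklore] -/
theorem dilutedStar_u₂ {u₁ u₂ u₃ t : K} (ht : t ≠ 0) (h₁ : t + u₁ ≠ 0) (h₂ : t + u₂ ≠ 0) (h₃ : t + u₃ ≠ 0) :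
    (t + u₁) * (t + u₂) * (t + u₃) / t ^ 2 * ((t / (t + u₃)) * (t / (t + u₁)) * (1 - t / (t + u₂))) = u₂ := by
  field_simp; ring

/-- Diluted star, petal `u₃`: `s·βγ(1−α) = u₃`. [folklore] -/
theorem dilutedStar_u₃ {u₁ u₂ u₃ t : K} (ht : t ≠ 0) (h₁ : t + u₁ ≠ 0) (h₂ : t + u₂ ≠ 0) (h₃ : t + u₃ ≠ 0) :
    (t + u₁) * (t + u₂) * (t + u₃) / t ^ 2 * ((t / (t + u₂)) * (t / (t + u₁)) * (1 - t / (t + u₃))) = u₃ := by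
  field_simp; ring

/-- Diluted star, kernel: `s·αβγ = t`. [folklore] -/
theorem dilutedStar_t {u₁ u₂ u₃ t : K} (ht : t ≠ 0) (h₁ : t + u₁ ≠ 0) (h₂ : t + u₂ ≠ 0) (h₃ : t + u₃ ≠ 0) :
    (t + u₁) * (t + u₂) * (t + u₃) / t ^ 2 * ((t / (t + u₃)) * (t / (t + u₂)) * (t / (t + u₁))) = t := by
  field_simp

/-- Diluted star, bottom cell: `(1 − s) + s·q_⋆(α,β,γ) = q` on the simplex. [folklore] -/
theorem dilutedStar_q {q u₁ u₂ u₃ t : K} (hσ : q + u₁ + u₂ + u₃ + t = 1) (ht : t ≠ 0) (h₁ : t + u₁ ≠ 0) (h₂ : t + u₂ ≠ 0)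
    (h₃ : t + u₃ ≠ 0) :
    (1 - (t + u₁) * (t + u₂) * (t + u₃) / t ^ 2) + (t + u₁) * (t + u₂) * (t + u₃) / t ^ 2 *
        (1 - ((t / (t + u₃)) * (t / (t + u₂)) + (t / (t + u₃)) * (t / (t + u₁)) + (t / (t + u₂)) * (t / (t + u₁)))
          + 2 * ((t / (t + u₃)) * (t / (t + u₂)) * (t / (t + u₁)))) = q := by
  have hq : q = 1 - u₁ - u₂ - u₃ - t := by linear_combination hσ
  subst hq
  field_simp; ring

/-- The dilution is a probability exactly when `Ha ≥ 0`: `1 − s = Ha / t²` on the simplex. [folklore] -/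
theorem dilutedStar_one_sub_survival {q u₁ u₂ u₃ t : K} (hσ : q + u₁ + u₂ + u₃ + t = 1) (ht : t ≠ 0) :
    1 - (t + u₁) * (t + u₂) * (t + u₃) / t ^ 2 = Ha q u₁ u₂ u₃ t / t ^ 2 := by
  rw [Ha_eq_sq_sub_prod hσ]
  field_simp

/-- CLAMPED TRIANGLE (dual statement), petal `u₁`: with edges `z = u₁/(q+u₁)` (`ab`), `y = u₂/(q+u₂)` (`ac`), `x = u₃/(q+u₃)` (`bc`)
and survival `s = (q+u₁)(q+u₂)(q+u₃)/q²`, `s·z(1−x)(1−y) = u₁`. [folklore] -/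
theorem clampedTriangle_u₁ {q u₁ u₂ u₃ : K} (hq : q ≠ 0) (h₁ : q + u₁ ≠ 0) (h₂ : q + u₂ ≠ 0) (h₃ : q + u₃ ≠ 0) :
    (q + u₁) * (q + u₂) * (q + u₃) / q ^ 2 * (u₁ / (q + u₁) * (1 - u₃ / (q + u₃)) * (1 - u₂ / (q + u₂))) = u₁ := by
  field_simp; ring

/-- Clamped triangle, bottom cell: `s·(1−x)(1−y)(1−z) = q`. [folklore] -/
theorem clampedTriangle_q {q u₁ u₂ u₃ : K} (hq : q ≠ 0) (h₁ : q + u₁ ≠ 0) (h₂ : q + u₂ ≠ 0) (h₃ : q + u₃ ≠ 0) :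
    (q + u₁) * (q + u₂) * (q + u₃) / q ^ 2 *
        ((1 - u₃ / (q + u₃)) * (1 - u₂ / (q + u₂)) * (1 - u₁ / (q + u₁))) = q := by
  field_simp; ring

/-- The clamping is a probability exactly when `Hb ≥ 0`: `1 − s = Hb / q²` on the simplex. [folklore] -/
theorem clampedTriangle_one_sub_survival {q u₁ u₂ u₃ t : K} (hσ : q + u₁ + u₂ + u₃ + t = 1) (hq : q ≠ 0) :
    1 - (q + u₁) * (q + u₂) * (q + u₃) / q ^ 2 = Hb q u₁ u₂ u₃ t / q ^ 2 := by
  rw [Hb_eq_sq_sub_prod hσ]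
  field_simp

end Canonical

/-! ### Real consequences -/

/-- For `AG ≥ 0`: `max(Ha, Hb) = max(q,t)·AG − e₃`, i.e. `Hmax3 ≥ 0 ⟺ Ha ≥ 0 ∨ Hb ≥ 0`. [folklore] -/
theorem max_Ha_Hb {q u₁ u₂ u₃ t : ℝ} (hag : 0 ≤ AG q u₁ u₂ u₃ t) :
    max (Ha q u₁ u₂ u₃ t) (Hb q u₁ u₂ u₃ t) = max q t * AG q u₁ u₂ u₃ t - u₁ * u₂ * u₃ := by
  have eHa : Ha q u₁ u₂ u₃ t = t * AG q u₁ u₂ u₃ t - u₁ * u₂ * u₃ := by simp only [Ha, AG]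
  have eHb : Hb q u₁ u₂ u₃ t = q * AG q u₁ u₂ u₃ t - u₁ * u₂ * u₃ := by simp only [Hb, AG]
  rw [eHa, eHb]
  rcases le_total q t with h | h
  · rw [max_eq_right h, max_eq_left]
    nlinarith [mul_le_mul_of_nonneg_right h hag]
  · rw [max_eq_left h, max_eq_right]
    nlinarith [mul_le_mul_of_nonneg_right h hag]

/-- `Hmax3 ⇒ H_{q+t}`: for nonnegative `q, t` and `AG ≥ 0`, `max(Ha,Hb) ≤ Hqt` (and `Hqt ≤ Ξ ≤ F` on the simplex, `…TerminalClosure`).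
[folklore] -/
theorem Hqt_ge_max {q u₁ u₂ u₃ t : ℝ} (hq : 0 ≤ q) (ht : 0 ≤ t) (hag : 0 ≤ AG q u₁ u₂ u₃ t) :
    max (Ha q u₁ u₂ u₃ t) (Hb q u₁ u₂ u₃ t) ≤ Hqt q u₁ u₂ u₃ t := by
  have hHqt : Hqt q u₁ u₂ u₃ t = (q + t) * AG q u₁ u₂ u₃ t - u₁ * u₂ * u₃ := by simp only [Hqt, AG]
  have eHa : Ha q u₁ u₂ u₃ t = t * AG q u₁ u₂ u₃ t - u₁ * u₂ * u₃ := by simp only [Ha, AG]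
  have eHb : Hb q u₁ u₂ u₃ t = q * AG q u₁ u₂ u₃ t - u₁ * u₂ * u₃ := by simp only [Hb, AG]
  rw [hHqt, eHa, eHb, max_le_iff]
  constructor <;> nlinarith [mul_nonneg hq hag, mul_nonneg ht hag]

/-! ### Clamp and dilution (join with the all-glued two-point law / meet with the all-separated one) -/

/-- `AG` under the CLAMP `K_ε x = (1−ε)x + ε·δ_T` (glue all three terminals with probability `ε`):
`AG(K_ε x) = (1−ε)((1−ε)AG + εq)`. [folklore] -/
theorem AG_clamp (q u₁ u₂ u₃ t ε : R) :
    AG ((1 - ε) * q) ((1 - ε) * u₁) ((1 - ε) * u₂) ((1 - ε) * u₃) ((1 - ε) * t + ε) =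
      (1 - ε) * ((1 - ε) * AG q u₁ u₂ u₃ t + ε * q) := by
  simp only [AG]; ring

/-- `Hb` under the clamp: `Hb(K_ε x) = (1−ε)²((1−ε)Hb + εq²)`. [folklore] -/
theorem Hb_clamp (q u₁ u₂ u₃ t ε : R) :
    Hb ((1 - ε) * q) ((1 - ε) * u₁) ((1 - ε) * u₂) ((1 - ε) * u₃) ((1 - ε) * t + ε) =
      (1 - ε) ^ 2 * ((1 - ε) * Hb q u₁ u₂ u₃ t + ε * q ^ 2) := by
  simp only [Hb]; ring

/-- `Ha` under the clamp: `Ha(K_ε x) = (1−ε)((1−ε)²Ha + ε(1−ε)(AG + tq) + ε²q)`. [folklore] -/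
theorem Ha_clamp (q u₁ u₂ u₃ t ε : R) :
    Ha ((1 - ε) * q) ((1 - ε) * u₁) ((1 - ε) * u₂) ((1 - ε) * u₃) ((1 - ε) * t + ε) =
      (1 - ε) * ((1 - ε) ^ 2 * Ha q u₁ u₂ u₃ t + ε * (1 - ε) * (AG q u₁ u₂ u₃ t + t * q) + ε ^ 2 * q) := by
  simp only [Ha, AG]; ring

/-- `Ha` under the DILUTION `Δ_ε x = (1−ε)x + ε·δ_B` (separate everything with probability `ε`; dual of the clamp):
`Ha(Δ_ε x) = (1−ε)²((1−ε)Ha + εt²)`. [folklore] -/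
theorem Ha_dilute (q u₁ u₂ u₃ t ε : R) :
    Ha ((1 - ε) * q + ε) ((1 - ε) * u₁) ((1 - ε) * u₂) ((1 - ε) * u₃) ((1 - ε) * t) =
      (1 - ε) ^ 2 * ((1 - ε) * Ha q u₁ u₂ u₃ t + ε * t ^ 2) := by
  simp only [Ha]; ring

/-- `Hb` under the dilution: `Hb(Δ_ε x) = (1−ε)((1−ε)²Hb + ε(1−ε)(AG + tq) + ε²t)`. [folklore] -/
theorem Hb_dilute (q u₁ u₂ u₃ t ε : R) :
    Hb ((1 - ε) * q + ε) ((1 - ε) * u₁) ((1 - ε) * u₂) ((1 - ε) * u₃) ((1 - ε) * t) =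
      (1 - ε) * ((1 - ε) ^ 2 * Hb q u₁ u₂ u₃ t + ε * (1 - ε) * (AG q u₁ u₂ u₃ t + t * q) + ε ^ 2 * t) := by
  simp only [Hb, AG]; ring

/-- `{AG ≥ 0, max(Ha,Hb) ≥ 0}` is invariant under the clamp `K_ε` (`ε ∈ [0,1]`, cells `q,t ≥ 0`): each face separately stays
nonnegative.  With FACT B (every law with `Hb ≥ 0` is a product of three chords and a clamp under parallel composition) and
`maxH_edge_ab_nonneg`, this gives closure of `{AG ≥ 0, Hmax3 ≥ 0}` under parallel composition with ANY clamped-triangle law; dually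
(`Ha_dilute`, `Hb_dilute`, `maxH_pendant_a_nonneg`) under the meet with any diluted-star law. [folklore] -/
theorem maxH_clamp_nonneg {q u₁ u₂ u₃ t ε : ℝ} (hq : 0 ≤ q) (ht : 0 ≤ t) (hε₀ : 0 ≤ ε) (hε₁ : ε ≤ 1)
    (hag : 0 ≤ AG q u₁ u₂ u₃ t) (hH : 0 ≤ max (Ha q u₁ u₂ u₃ t) (Hb q u₁ u₂ u₃ t)) :
    0 ≤ max (Ha ((1 - ε) * q) ((1 - ε) * u₁) ((1 - ε) * u₂) ((1 - ε) * u₃) ((1 - ε) * t + ε))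
      (Hb ((1 - ε) * q) ((1 - ε) * u₁) ((1 - ε) * u₂) ((1 - ε) * u₃) ((1 - ε) * t + ε)) := by
  have hm : 0 ≤ 1 - ε := by linarith
  rcases le_max_iff.mp hH with ha | hb
  · refine le_max_of_le_left ?_
    rw [Ha_clamp]
    refine mul_nonneg hm (add_nonneg (add_nonneg (mul_nonneg (sq_nonneg _) ha) ?_) (mul_nonneg (sq_nonneg _) hq))
    exact mul_nonneg (mul_nonneg hε₀ hm) (add_nonneg hag (mul_nonneg ht hq))
  · refine le_max_of_le_right ?_
    rw [Hb_clamp]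
    exact mul_nonneg (sq_nonneg _) (add_nonneg (mul_nonneg hm hb) (mul_nonneg hε₀ (sq_nonneg _)))

/-- Dual: `{AG ≥ 0, max(Ha,Hb) ≥ 0}` is invariant under the dilution `Δ_ε`. [folklore] -/
theorem maxH_dilute_nonneg {q u₁ u₂ u₃ t ε : ℝ} (hq : 0 ≤ q) (ht : 0 ≤ t) (hε₀ : 0 ≤ ε) (hε₁ : ε ≤ 1)
    (hag : 0 ≤ AG q u₁ u₂ u₃ t) (hH : 0 ≤ max (Ha q u₁ u₂ u₃ t) (Hb q u₁ u₂ u₃ t)) :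
    0 ≤ max (Ha ((1 - ε) * q + ε) ((1 - ε) * u₁) ((1 - ε) * u₂) ((1 - ε) * u₃) ((1 - ε) * t))
      (Hb ((1 - ε) * q + ε) ((1 - ε) * u₁) ((1 - ε) * u₂) ((1 - ε) * u₃) ((1 - ε) * t)) := by
  have hm : 0 ≤ 1 - ε := by linarith
  rcases le_max_iff.mp hH with ha | hb
  · refine le_max_of_le_left ?_
    rw [Ha_dilute]
    exact mul_nonneg (sq_nonneg _) (add_nonneg (mul_nonneg hm ha) (mul_nonneg hε₀ (sq_nonneg _)))
  · refine le_max_of_le_right ?_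
    rw [Hb_dilute]
    refine mul_nonneg hm (add_nonneg (add_nonneg (mul_nonneg (sq_nonneg _) hb) ?_) (mul_nonneg (sq_nonneg _) ht))
    exact mul_nonneg (mul_nonneg hε₀ hm) (add_nonneg hag (mul_nonneg ht hq))

end CubicThreePointSharp

end Summit.CriticalPhenomena.PercolationContinuityZ3.Theorems
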